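import Summits.PneNP.PneNP.Theorems.KarlinRubinMonotoneBlindDnfPlanted

/-!
# Route KarlinRubin, crux `MonotoneBlind` (stmt-PneNP-18027), line `Sketch` (vertex-cover duality): stub `stub_plantingBound`

The planting identity in the inequality form the line consumes. Under the planted-clique law
`G(n,1/2,k)` (`A` uniform in `kSubsets n k`, noise `x ∼ G(n,1/2)`, output `plant A x = x ∪ K_A`) the
acceptance probability of any test `f : EdgeVec n → Bool` is the noise-average of the uniform-`k`-set
measure of the clique-completion up-set `U_f(x) = {A | f (plant A x) = 1}`:

* `plantedCliqueDist_eq_bind_noise` — the planted law fibred over the NOISE (`PMF.bind_comm`):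
  `G(n,1/2,k) = x ∼ G(n,1/2); A ∼ kSubsets; return plant A x`;
* `plantedCliqueDist_toOuterMeasure_eq_tsum` — `Pr_{G(n,1/2,k)}[S] = ∑' x, Pr[x] · μ_k {A | plant A x ∈ S}`;
* `stub_plantingBound` — if `μ_k(U_f(x)) ≤ η` for every `x` off a noise set `B`, then
  `Pr_{G(n,1/2,k)}[f = 1] ≤ η + Pr_{G(n,1/2)}[B]` (split the sum over `x ∈ B`, where the inner measure is
  `≤ 1`, and `x ∉ B`, where it is `≤ η`; `∑' x, Pr[x] = 1`).

All `--supports stmt-PneNP-18027`; no definitions.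
-/

set_option linter.dupNamespace false -- `Summit.PneNP.PneNP.…` is the layout-mandated namespace (D-0017)

namespace Summit.PneNP.PneNP.Theorems.MonotoneBlind.VertexCover

open Literature.Computability.Complexity Literature.Probability.RandomGraphs.PlantedClique Filter Finset
open scoped ENNReal Topology Classical

/-- A `PMF` gives every event outer measure at most `1`. [folklore] -/
private theorem toOuterMeasure_le_one {α : Type*} (p : PMF α) (s : Set α) :
    p.toOuterMeasure s ≤ 1 :=
  (p.toOuterMeasure.mono (Set.subset_univ s)).trans_eq
    ((PMF.toOuterMeasure_apply_eq_one_iff p Set.univ).2 (Set.subset_univ _))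

/-- **The planted law, fibred over the noise.** Drawing the planted set first and the noise second
is the same as drawing the noise `x ∼ G(n,1/2)` first and then planting a uniform `A ∈ kSubsets n k`
into it (`PMF.bind_comm`). [folklore] -/
theorem plantedCliqueDist_eq_bind_noise (n k : ℕ) :
    plantedCliqueDist n k =
      (erdosRenyiHalf n).bind fun x =>
        (PMF.uniformOfFinset (kSubsets n k) (kSubsets_nonempty n k)).map fun A => plant A x := by
  rw [plantedCliqueDist, plantedCliqueJoint, PMF.map_bind]
  simp only [PMF.map_comp, Function.comp_def]
  simp only [PMF.map, Function.comp_def]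
  exact PMF.bind_comm _ _ _

/-- **The planting identity.** For every event `S`,
`Pr_{G(n,1/2,k)}[S] = ∑' x, Pr_{G(n,1/2)}[x] · μ_k {A | plant A x ∈ S}`, `μ_k` the uniform law on
`kSubsets n k`. [folklore] -/
theorem plantedCliqueDist_toOuterMeasure_eq_tsum (n k : ℕ) (S : Set (EdgeVec n)) :
    (plantedCliqueDist n k).toOuterMeasure S =
      ∑' x, erdosRenyiHalf n x *
        (PMF.uniformOfFinset (kSubsets n k) (kSubsets_nonempty n k)).toOuterMeasure
          {A | plant A x ∈ S} := by
  rw [plantedCliqueDist_eq_bind_noise, PMF.toOuterMeasure_bind_apply]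
  refine tsum_congr fun x => ?_
  rw [PMF.toOuterMeasure_map_apply]
  rfl

/-- **stub_plantingBound** (the planting identity `Pr_P[f = 1] = E_x μ_k(U_f(x))` in inequality form).
For every test `f` (no monotonicity needed), threshold `η` and noise set `B`: if
`μ_k {A | f (plant A x) = 1} ≤ η` for every `x ∉ B`, then `Pr_{G(n,1/2,k)}[f = 1] ≤ η + Pr_{G(n,1/2)}[B]`.
Proof: fibre the planted law over the noise (`plantedCliqueDist_toOuterMeasure_eq_tsum`) and bound the
summand by `Pr[x] · η` off `B` and by `Pr[x]` on `B`. [folklore] -/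
theorem stub_plantingBound :
    ∀ (n k : ℕ) (f : EdgeVec n → Bool) (η : ℝ≥0∞) (B : Set (EdgeVec n)),
      (∀ x, x ∉ B →
        (PMF.uniformOfFinset (kSubsets n k) (kSubsets_nonempty n k)).toOuterMeasure
          {A | f (plant A x) = true} ≤ η) →
      (plantedCliqueDist n k).toOuterMeasure {y | f y = true} ≤
        η + (erdosRenyiHalf n).toOuterMeasure B := by
  intro n k f η B hB
  calc (plantedCliqueDist n k).toOuterMeasure {y | f y = true}
      = ∑' x, erdosRenyiHalf n x *
          (PMF.uniformOfFinset (kSubsets n k) (kSubsets_nonempty n k)).toOuterMeasure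
            {A | f (plant A x) = true} :=
        plantedCliqueDist_toOuterMeasure_eq_tsum n k _
    _ ≤ ∑' x, (erdosRenyiHalf n x * η + B.indicator (erdosRenyiHalf n) x) := by
        refine ENNReal.tsum_le_tsum fun x => ?_
        by_cases hx : x ∈ B
        · rw [Set.indicator_of_mem hx]
          exact (mul_le_of_le_one_right' (toOuterMeasure_le_one _ _)).trans le_add_self
        · rw [Set.indicator_of_notMem hx, add_zero]
          exact mul_le_mul' le_rfl (hB x hx)
    _ = η + (erdosRenyiHalf n).toOuterMeasure B := by
        rw [ENNReal.tsum_add, ENNReal.tsum_mul_right, PMF.tsum_coe, one_mul,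
          PMF.toOuterMeasure_apply]

end Summit.PneNP.PneNP.Theorems.MonotoneBlind.VertexCover
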